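import Mathlib
import Summits.NavierStokesRegularity.NavierStokesRegularity.Theorems.SlicedKelvinPlanarFluxAPrioriEpsilonLimit

/-!
# Crux `SlicedKelvin.PlanarFluxAPriori` (stmt-NavierStokesRegularity-15600), line `registered`:
  parametric integrals over the plane foliation `y ↦ R (y₀, y₁, c)` (helper for `stub_foldLawPackage`)

The registered stub `stub_foldLawPackage` of the skeleton `Cruxes/PlanarFluxAPriori/Lines/birth.lean`
assembles the ε-fold-law subsolution package `Theorems.SlicedKelvin.FoldLawSubsolution`: the regularised
planar flux profile `φ_ε(τ, c) = ∫_{y ∈ ℝ²} g(τ, R(y₀, y₁, c)) dy` and its `τ`- and `c`-derivatives are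
PARAMETRIC PLANE INTEGRALS of fields `g(τ, x)` on `[0,T) × ℝ³` all of which decay like `(1 + ‖x‖)⁻³`.
This file proves, once and for all and with no fluid mechanics, the dominated-convergence bookkeeping of
such integrals (Mathlib `continuousOn_of_dominated`, `hasDerivAt_integral_of_dominated_loc_of_deriv_le`,
`integrable_one_add_norm` in dimension `2 < 3`):

* `norm_le_norm_plane`, `rpow_neg_three_plane_le`, `le_max_mul_rpow_of_le` — the chart does not decrease
  norms, so the weight `(1 + ‖R(y₀,y₁,c)‖)⁻³ ≤ (1 + ‖y‖)⁻³` is dominated by an integrable function of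
  `y ∈ ℝ²` alone (`integrable_rpow_neg_three`);
* `plane_eq_add_smul`, `hasDerivAt_plane`, `continuous_plane_height` — `R(y₀,y₁,c) = R(y₀,y₁,0) + c • R e₂`;
* `integrable_plane_of_norm_le`, `abs_planeIntegral_le` — integrability and the bound
  `|∫ G ∘ P_c| ≤ K ∫ (1 + ‖y‖)⁻³` for `|G| ≤ K (1 + ‖x‖)⁻³`;
* `continuousOn_planeIntegral` — joint continuity in `(τ, c)`;
* `hasDerivAt_planeIntegral_height` — `∂_c ∫ G ∘ P_c = ∫ DG[R e₂] ∘ P_c` (registered sub-goal);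
* `hasDerivAt_planeIntegral_time` — `∂_τ ∫ g(τ, P_c y) dy = ∫ ∂_τ g(τ, P_c y) dy`.
-/

noncomputable section

-- Problem = summit for this single-conjunct summit: the duplicate namespace component is deliberate.
set_option linter.dupNamespace false

namespace Summit.NavierStokesRegularity.NavierStokesRegularity.Theorems.SlicedKelvinPlanarFluxAPriori

open MeasureTheory Set Filter Topology

/-! ### The plane chart `y ↦ R (y₀, y₁, c)` -/

/-- The lift `y ↦ (y₀, y₁, c)` of `ℝ²` onto the plane `{x₂ = c}` does not decrease norms. -/
theorem norm_le_norm_planeLift' (y : EuclideanSpace ℝ (Fin 2)) (c : ℝ) :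
    ‖y‖ ≤ ‖(WithLp.toLp 2 ![y 0, y 1, c] : EuclideanSpace ℝ (Fin 3))‖ := by
  rw [EuclideanSpace.norm_eq, EuclideanSpace.norm_eq]
  apply Real.sqrt_le_sqrt
  simp only [Fin.sum_univ_two, Fin.sum_univ_three, Real.norm_eq_abs, sq_abs]
  simp
  nlinarith [sq_nonneg c]

/-- The chart `y ↦ R (y₀, y₁, c)` of the plane `R{x₂ = c}` does not decrease norms. -/
theorem norm_le_norm_plane (R : EuclideanSpace ℝ (Fin 3) ≃ₗᵢ[ℝ] EuclideanSpace ℝ (Fin 3))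
    (y : EuclideanSpace ℝ (Fin 2)) (c : ℝ) : ‖y‖ ≤ ‖R (WithLp.toLp 2 ![y 0, y 1, c])‖ := by
  rw [LinearIsometryEquiv.norm_map]
  exact norm_le_norm_planeLift' y c

/-- Weight transfer along the chart: `(1 + ‖R(y₀,y₁,c)‖)⁻³ ≤ (1 + ‖y‖)⁻³`. -/
theorem rpow_neg_three_plane_le (R : EuclideanSpace ℝ (Fin 3) ≃ₗᵢ[ℝ] EuclideanSpace ℝ (Fin 3))
    (y : EuclideanSpace ℝ (Fin 2)) (c : ℝ) :
    (1 + ‖R (WithLp.toLp 2 ![y 0, y 1, c])‖) ^ (-(3 : ℝ)) ≤ (1 + ‖y‖) ^ (-(3 : ℝ)) :=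
  Real.rpow_le_rpow_of_nonpos (by positivity) (by linarith [norm_le_norm_plane R y c]) (by norm_num)

/-- Weight transfer with an arbitrary real constant: `a ≤ K (1 + ‖R(y₀,y₁,c)‖)⁻³` gives
`a ≤ max K 0 · (1 + ‖y‖)⁻³`. -/
theorem le_max_mul_rpow_of_le (R : EuclideanSpace ℝ (Fin 3) ≃ₗᵢ[ℝ] EuclideanSpace ℝ (Fin 3))
    (y : EuclideanSpace ℝ (Fin 2)) (c : ℝ) {a K : ℝ}
    (h : a ≤ K * (1 + ‖R (WithLp.toLp 2 ![y 0, y 1, c])‖) ^ (-(3 : ℝ))) :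
    a ≤ max K 0 * (1 + ‖y‖) ^ (-(3 : ℝ)) := by
  refine h.trans ?_
  calc K * (1 + ‖R (WithLp.toLp 2 ![y 0, y 1, c])‖) ^ (-(3 : ℝ))
      ≤ max K 0 * (1 + ‖R (WithLp.toLp 2 ![y 0, y 1, c])‖) ^ (-(3 : ℝ)) :=
        mul_le_mul_of_nonneg_right (le_max_left _ _) (by positivity)
    _ ≤ max K 0 * (1 + ‖y‖) ^ (-(3 : ℝ)) :=
        mul_le_mul_of_nonneg_left (rpow_neg_three_plane_le R y c) (le_max_right _ _)

/-- The weight `(1 + ‖y‖)⁻³` is integrable on `ℝ²` (`2 < 3`). -/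
theorem integrable_rpow_neg_three :
    Integrable (fun y : EuclideanSpace ℝ (Fin 2) => (1 + ‖y‖) ^ (-(3 : ℝ))) :=
  integrable_one_add_norm (by rw [finrank_euclideanSpace_fin]; norm_num)

/-- The plane integral of the weight is nonnegative. -/
theorem integral_rpow_neg_three_nonneg :
    0 ≤ ∫ y : EuclideanSpace ℝ (Fin 2), (1 + ‖y‖) ^ (-(3 : ℝ)) :=
  integral_nonneg fun y => by positivity

/-- The chart is affine in the height: `R(y₀, y₁, c) = R(y₀, y₁, 0) + c • R e₂`. -/
theorem plane_eq_add_smul (R : EuclideanSpace ℝ (Fin 3) ≃ₗᵢ[ℝ] EuclideanSpace ℝ (Fin 3))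
    (y : EuclideanSpace ℝ (Fin 2)) (c : ℝ) :
    R (WithLp.toLp 2 ![y 0, y 1, c]) =
      R (WithLp.toLp 2 ![y 0, y 1, 0]) + c • R (EuclideanSpace.single 2 1) := by
  rw [← LinearIsometryEquiv.map_smul, ← LinearIsometryEquiv.map_add]
  congr 1
  ext i
  fin_cases i <;> simp

/-- The chart has height-derivative the unit normal `R e₂`. -/
theorem hasDerivAt_plane (R : EuclideanSpace ℝ (Fin 3) ≃ₗᵢ[ℝ] EuclideanSpace ℝ (Fin 3))
    (y : EuclideanSpace ℝ (Fin 2)) (c : ℝ) :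
    HasDerivAt (fun c : ℝ => R (WithLp.toLp 2 ![y 0, y 1, c])) (R (EuclideanSpace.single 2 1)) c := by
  have h : (fun c : ℝ => R (WithLp.toLp 2 ![y 0, y 1, c])) =
      fun c => R (WithLp.toLp 2 ![y 0, y 1, 0]) + c • R (EuclideanSpace.single 2 1) :=
    funext fun c => plane_eq_add_smul R y c
  rw [h]
  simpa using ((hasDerivAt_id c).smul_const (R (EuclideanSpace.single 2 1))).const_add
    (R (WithLp.toLp 2 ![y 0, y 1, 0]))

/-- The chart is continuous in the height. -/
theorem continuous_plane_height (R : EuclideanSpace ℝ (Fin 3) ≃ₗᵢ[ℝ] EuclideanSpace ℝ (Fin 3))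
    (y : EuclideanSpace ℝ (Fin 2)) : Continuous fun c : ℝ => R (WithLp.toLp 2 ![y 0, y 1, c]) :=
  continuous_iff_continuousAt.2 fun c => (hasDerivAt_plane R y c).continuousAt

/-! ### Plane integrals of decaying functions -/

/-- A continuous `G` with `‖G x‖ ≤ K (1 + ‖x‖)⁻³` is integrable on every plane `R{x₂ = c}`. -/
theorem integrable_plane_of_norm_le {E' : Type*} [NormedAddCommGroup E']
    (R : EuclideanSpace ℝ (Fin 3) ≃ₗᵢ[ℝ] EuclideanSpace ℝ (Fin 3)) {G : EuclideanSpace ℝ (Fin 3) → E'}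
    (hG : Continuous G) {K : ℝ} (h : ∀ x, ‖G x‖ ≤ K * (1 + ‖x‖) ^ (-(3 : ℝ))) (c : ℝ) :
    Integrable (fun y : EuclideanSpace ℝ (Fin 2) => G (R (WithLp.toLp 2 ![y 0, y 1, c]))) :=
  Integrable.mono' (integrable_rpow_neg_three.const_mul (max K 0))
    (hG.comp (continuous_plane R c)).aestronglyMeasurable
    (ae_of_all _ fun y => le_max_mul_rpow_of_le R y c (h _))

/-- `|∫_{R{x₂=c}} G| ≤ K ∫ (1 + ‖y‖)⁻³` when `|G x| ≤ K (1 + ‖x‖)⁻³` with `0 ≤ K`. -/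
theorem abs_planeIntegral_le (R : EuclideanSpace ℝ (Fin 3) ≃ₗᵢ[ℝ] EuclideanSpace ℝ (Fin 3))
    {G : EuclideanSpace ℝ (Fin 3) → ℝ} {K : ℝ} (hK : 0 ≤ K)
    (h : ∀ x, |G x| ≤ K * (1 + ‖x‖) ^ (-(3 : ℝ))) (c : ℝ) :
    |∫ y : EuclideanSpace ℝ (Fin 2), G (R (WithLp.toLp 2 ![y 0, y 1, c]))| ≤
      K * ∫ y : EuclideanSpace ℝ (Fin 2), (1 + ‖y‖) ^ (-(3 : ℝ)) := by
  rw [← Real.norm_eq_abs, ← integral_const_mul]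
  refine norm_integral_le_of_norm_le (integrable_rpow_neg_three.const_mul K) (ae_of_all _ fun y => ?_)
  rw [Real.norm_eq_abs]
  exact (h _).trans (mul_le_mul_of_nonneg_left (rpow_neg_three_plane_le R y c) hK)

/-- **Joint continuity of a parametric plane integral.** If `g(τ, x)` is jointly continuous on
`S × ℝ³` and `|g(τ, x)| ≤ K (1 + ‖x‖)⁻³` there, then `(τ, c) ↦ ∫ g(τ, R(y₀,y₁,c)) dy` is jointly
continuous on `S × ℝ` (dominated convergence). -/
theorem continuousOn_planeIntegral (R : EuclideanSpace ℝ (Fin 3) ≃ₗᵢ[ℝ] EuclideanSpace ℝ (Fin 3))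
    {S : Set ℝ} {g : ℝ → EuclideanSpace ℝ (Fin 3) → ℝ} {K : ℝ}
    (hg : ContinuousOn (Function.uncurry g) (S ×ˢ univ))
    (hK : ∀ τ ∈ S, ∀ x, |g τ x| ≤ K * (1 + ‖x‖) ^ (-(3 : ℝ))) :
    ContinuousOn (Function.uncurry fun τ c =>
      ∫ y : EuclideanSpace ℝ (Fin 2), g τ (R (WithLp.toLp 2 ![y 0, y 1, c]))) (S ×ˢ univ) := by
  have hslice : ∀ τ ∈ S, Continuous (g τ) := fun τ hτ =>
    hg.comp_continuous (continuous_const.prodMk continuous_id) fun x => mk_mem_prod hτ (mem_univ x)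
  refine continuousOn_of_dominated
    (F := fun (p : ℝ × ℝ) (y : EuclideanSpace ℝ (Fin 2)) => g p.1 (R (WithLp.toLp 2 ![y 0, y 1, p.2])))
    (bound := fun y => max K 0 * (1 + ‖y‖) ^ (-(3 : ℝ))) ?_ ?_ ?_ ?_
  · rintro ⟨τ, c⟩ ⟨hτ, -⟩
    exact ((hslice τ hτ).comp (continuous_plane R c)).aestronglyMeasurable
  · rintro ⟨τ, c⟩ ⟨hτ, -⟩
    refine ae_of_all _ fun y => ?_
    rw [Real.norm_eq_abs]
    exact le_max_mul_rpow_of_le R y c (hK τ hτ _)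
  · exact integrable_rpow_neg_three.const_mul _
  · refine ae_of_all _ fun y => ?_
    have hc : Continuous fun p : ℝ × ℝ => ((p.1, R (WithLp.toLp 2 ![y 0, y 1, p.2])) :
        ℝ × EuclideanSpace ℝ (Fin 3)) :=
      continuous_fst.prodMk ((continuous_plane_height R y).comp continuous_snd)
    exact hg.comp hc.continuousOn fun p hp => mk_mem_prod hp.1 (mem_univ _)

/-- **Differentiating a plane integral in the height.** For `G ∈ C¹(ℝ³)` with `|G|` and `‖DG‖`
bounded by `K₀ (1 + ‖x‖)⁻³`, `K₁ (1 + ‖x‖)⁻³`, the plane integral `c ↦ ∫ G(R(y₀,y₁,c)) dy` is differentiable with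
derivative `∫ DG(R(y₀,y₁,c))[R e₂] dy` (dominated differentiation under the integral sign; the
`c`-derivative of the chart is the unit normal `R e₂`). Registered sub-goal of `stub_foldLawPackage`. -/
theorem hasDerivAt_planeIntegral_height : ∀ (R : EuclideanSpace ℝ (Fin 3) ≃ₗᵢ[ℝ] EuclideanSpace ℝ (Fin 3)) (G : EuclideanSpace ℝ (Fin 3) → ℝ) (K₀ K₁ : ℝ), ContDiff ℝ 1 G → (∀ x, |G x| ≤ K₀ * (1 + ‖x‖) ^ (-(3 : ℝ))) → (∀ x, ‖fderiv ℝ G x‖ ≤ K₁ * (1 + ‖x‖) ^ (-(3 : ℝ))) → ∀ (c : ℝ), HasDerivAt (fun c : ℝ => ∫ y : EuclideanSpace ℝ (Fin 2), G (R (WithLp.toLp 2 ![y 0, y 1, c]))) (∫ y : EuclideanSpace ℝ (Fin 2), fderiv ℝ G (R (WithLp.toLp 2 ![y 0, y 1, c])) (R (EuclideanSpace.single 2 1))) c := by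
  intro R G K₀ K₁ hG h0 h1 c
  have hGc : Continuous G := hG.continuous
  have hG'c : Continuous (fderiv ℝ G) := hG.continuous_fderiv one_ne_zero
  have hdiff : ∀ x, DifferentiableAt ℝ G x := fun x => hG.differentiable one_ne_zero x
  have hn : ‖R (EuclideanSpace.single 2 (1 : ℝ))‖ = 1 := by
    rw [LinearIsometryEquiv.norm_map, PiLp.norm_single, norm_one]
  refine (hasDerivAt_integral_of_dominated_loc_of_deriv_le (μ := volume) (x₀ := c)
    (F := fun (c : ℝ) (y : EuclideanSpace ℝ (Fin 2)) => G (R (WithLp.toLp 2 ![y 0, y 1, c])))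
    (F' := fun (c : ℝ) (y : EuclideanSpace ℝ (Fin 2)) =>
      fderiv ℝ G (R (WithLp.toLp 2 ![y 0, y 1, c])) (R (EuclideanSpace.single 2 1)))
    (bound := fun y => max K₁ 0 * (1 + ‖y‖) ^ (-(3 : ℝ))) univ_mem ?_ ?_ ?_ ?_ ?_ ?_).2
  · exact Eventually.of_forall fun c' => (hGc.comp (continuous_plane R c')).aestronglyMeasurable
  · exact integrable_plane_of_norm_le R hGc (fun x => by rw [Real.norm_eq_abs]; exact h0 x) c
  · exact ((hG'c.comp (continuous_plane R c)).clm_apply continuous_const).aestronglyMeasurable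
  · refine ae_of_all _ fun y c' _ => le_max_mul_rpow_of_le R y c' ?_
    calc ‖fderiv ℝ G (R (WithLp.toLp 2 ![y 0, y 1, c'])) (R (EuclideanSpace.single 2 1))‖
        ≤ ‖fderiv ℝ G (R (WithLp.toLp 2 ![y 0, y 1, c']))‖ * ‖R (EuclideanSpace.single 2 (1 : ℝ))‖ :=
          ContinuousLinearMap.le_opNorm _ _
      _ = ‖fderiv ℝ G (R (WithLp.toLp 2 ![y 0, y 1, c']))‖ := by rw [hn, mul_one]
      _ ≤ K₁ * (1 + ‖R (WithLp.toLp 2 ![y 0, y 1, c'])‖) ^ (-(3 : ℝ)) := h1 _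
  · exact integrable_rpow_neg_three.const_mul _
  · exact ae_of_all _ fun y c' _ =>
      (hdiff _).hasFDerivAt.comp_hasDerivAt c' (hasDerivAt_plane R y c')

/-- **Differentiating a plane integral in time.** If, for `σ` in a neighbourhood `s` of `τ`, the
slices `g(σ, ·)` are continuous, `σ ↦ g(σ, x)` has derivative `g'(σ, x)` with
`|g'(σ, x)| ≤ K' (1 + ‖x‖)⁻³`, and `|g(τ, x)| ≤ K (1 + ‖x‖)⁻³`, `g'(τ, ·)` continuous, then
`σ ↦ ∫ g(σ, R(y₀,y₁,c)) dy` has derivative `∫ g'(τ, R(y₀,y₁,c)) dy` at `τ`. -/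
theorem hasDerivAt_planeIntegral_time (R : EuclideanSpace ℝ (Fin 3) ≃ₗᵢ[ℝ] EuclideanSpace ℝ (Fin 3))
    {s : Set ℝ} {τ : ℝ} (hs : s ∈ 𝓝 τ) {g g' : ℝ → EuclideanSpace ℝ (Fin 3) → ℝ} {K K' : ℝ}
    (hgc : ∀ σ ∈ s, Continuous (g σ)) (hg'c : Continuous (g' τ))
    (hgK : ∀ x, |g τ x| ≤ K * (1 + ‖x‖) ^ (-(3 : ℝ)))
    (hg'K : ∀ σ ∈ s, ∀ x, |g' σ x| ≤ K' * (1 + ‖x‖) ^ (-(3 : ℝ)))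
    (hd : ∀ σ ∈ s, ∀ x, HasDerivAt (fun σ => g σ x) (g' σ x) σ) (c : ℝ) :
    HasDerivAt (fun σ => ∫ y : EuclideanSpace ℝ (Fin 2), g σ (R (WithLp.toLp 2 ![y 0, y 1, c])))
      (∫ y : EuclideanSpace ℝ (Fin 2), g' τ (R (WithLp.toLp 2 ![y 0, y 1, c]))) τ := by
  have hτ : τ ∈ s := mem_of_mem_nhds hs
  refine (hasDerivAt_integral_of_dominated_loc_of_deriv_le (μ := volume) (x₀ := τ)
    (F := fun (σ : ℝ) (y : EuclideanSpace ℝ (Fin 2)) => g σ (R (WithLp.toLp 2 ![y 0, y 1, c])))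
    (F' := fun (σ : ℝ) (y : EuclideanSpace ℝ (Fin 2)) => g' σ (R (WithLp.toLp 2 ![y 0, y 1, c])))
    (bound := fun y => max K' 0 * (1 + ‖y‖) ^ (-(3 : ℝ))) hs ?_ ?_ ?_ ?_ ?_ ?_).2
  · filter_upwards [hs] with σ hσ using
      ((hgc σ hσ).comp (continuous_plane R c)).aestronglyMeasurable
  · exact integrable_plane_of_norm_le R (hgc τ hτ) (fun x => by rw [Real.norm_eq_abs]; exact hgK x) c
  · exact (hg'c.comp (continuous_plane R c)).aestronglyMeasurable
  · refine ae_of_all _ fun y σ hσ => le_max_mul_rpow_of_le R y c ?_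
    rw [Real.norm_eq_abs]
    exact hg'K σ hσ _
  · exact integrable_rpow_neg_three.const_mul _
  · exact ae_of_all _ fun y σ hσ => hd σ hσ _

end Summit.NavierStokesRegularity.NavierStokesRegularity.Theorems.SlicedKelvinPlanarFluxAPriori

end
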